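import Literature.MathematicalPhysics.QuantumFieldTheory.Balaban1983to89.Node00.Record8

/-!
# DAG node N26 — B4 «β-continuity» at NODE 00's Stage-8 β of record: WHAT THE β-LAYER READS THE COUPLING HISTORY THROUGH
# (located structure, kernel-checked): the merged term of step `k+1` at history `(g_0, …, g_k)` is `(0.19)` WITH BODY over the
# Radon–Nikodym transport of record and the characteristic function of record `χ_k` AT `g_k`; `χ_k` reads `g_k` only through the
# pair (`R_k` of [III] (2.5), `ε_k` of [III] (2.4)); `ε_k` is continuous in `g_k`, `R_k` is an ℕ-valued STEP FUNCTION of `g_k`,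
# unbounded as `g_k → 0⁺`, hence continuous on NO box `]0, γ]`

Cell `pub-ymgap`, YM-PLAN Track A (HUMAN RULING D-0062), seat `pub-ymgap-dag-n26-a` (gen 3; -a = KNIT-BY-NAME), eighth N26 companion; the
kernel half of the seat's located note [DAGN26A-G3 LOCATED-B4-VERSION + LOCATED-B4-RSTEP] (pub-ymgap INBOX l.10515).  COUNT-NEUTRAL
BOOKKEEPING about definitions of record (`Node00.SmallFieldChiOfRecord`, `Node00.BackgroundActionOfRecord`, `Node00.Record8`); THEOREMS ONLY,
no definition, no estimate; nothing of Bałaban's asserted or denied.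

WHY (N26 = «`β_{k+1}` of the datum of record is continuous in `(g_0, …, g_k)` on a box `]0, γc]^{k+1}`»).  At Stage 8 the β of record on its box
is the second moment (1.22) of the `K → ∞` limit of the Hessians (1.20) at `B = 0` of `B ↦ 𝓝_{k+1}(g; exp ρB)` (`Node00.Record8.βfun_stage8`,
`Node00.betaOfMerged_of_mem`, `Node00.betaMerged`, `Node00.polLimit ∕ polWindow ∕ polScalar`, `B12PolarizationTensor120.polComp ∕ polTensor`), and
§3 below displays `𝓝_{k+1}(g; W)` as `A_{k+1}(W) − A_k(Ū^k(U_k W))` with `A_{k+1} = log 𝐍_k⁻¹·(𝐓_k(χ_k e^{−GF∕g_k² + A_k}))` over the TRANSPORT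
OF RECORD `TrhoOfRecord` (a Radon–Nikodym VERSION, `AveragingRT.rnDensity`) and the χ OF RECORD `chi7 θ K g k = chiOfRecord …` AT `g_k`.  Two
located consequences for B4 (prose in the INBOX note; here only the kernel-checkable structure): (i) a second Fréchet derivative AT A POINT of
a version is not determined by the measure data; (ii) `chiOfRecord` reads `g_k` through `RkOfRecord` — [III] (2.5) «R_j is the smallest number of
the form L^r such, that R_j ≥ (log g_j⁻²)^r» — which §1 proves unbounded near `0⁺` and continuous on no `]0, γ]`, and through the
continuous threshold `ε_k = g_k A₀ (log g_k⁻²)^{p₀}` (§2).  Print's β is built with [I] (2.9) `χ_k = Π_b χ({|B′(b)| < ε₁})` (fixed `ε₁`, «or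
g_kγ_kε₁ … analytic») and is asserted «a smooth function defined on the interval [0, γ], (or analytic)» ([I] p. 264).

CONTENTS.  §1 `R_k` of record as a function of the coupling: `log_sq_inv_eq`, `tendsto_log_sq_inv_nhdsGT_zero`, `log_pow_le_RkOfRecord`,
`tendsto_RkOfRecord_nhdsGT_zero`, `exists_RkOfRecord_ne_of_pos`, `not_continuousOn_RkOfRecord`, `not_continuousOn_RkOfRecord_real`,
`exists_not_continuousWithinAt_RkOfRecord`.  §2 the two channels of `χ_k`: `chiOfRecord_congr` ∕ `chi7_congr` (χ_k reads the sequence at index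
`k` only), `chiOfRecord_eq_of_channels_eq` (… only through `(R_k(g_k), ε_k(g))`), `continuousOn_epsChannel`.  §3 `extd_apply_last`,
`mergedTermFamilyMat_eq_nextAction_sub` (the merged term family of the β-layer, unfolded ONE step: transport of record + `χ_k` at `g_k = hist (Fin.last k)`).
[Balaban1987RG1] = Commun. Math. Phys. **109** (1987) 249–301; [Balaban1988Convergent] = [III] = Commun. Math. Phys. **119** (1988) 243–285.
One finite four-torus family at fixed ε per run; NOTHING about the continuum limit, ℝ⁴, OS axioms, a mass gap or the Clay problem is proved or claimed.
-/

noncomputable section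

open Filter Topology
open scoped Matrix.Norms.L2Operator

namespace Summit.QuantumFields.YangMills.Theorems.BalabanUVNodesN26ChiStep

open Literature.MathematicalPhysics.QuantumFieldTheory.Balaban1983to89
open Literature.MathematicalPhysics.QuantumFieldTheory.Balaban1983to89.Node00
open Literature.MathematicalPhysics.QuantumFieldTheory.Balaban1983to89.T4Continuum (T4Family)
open Literature.MathematicalPhysics.QuantumFieldTheory.Balaban1983to89.T4FlagMemory (extd)
open Literature.MathematicalPhysics.QuantumFieldTheory.Balaban1983to89.B12Eq019ActionBody (nextAction)

/-! ## §1 `R_k` of record ([III] (2.5)) as a function of the coupling: unbounded near `0⁺`, ℕ-valued, continuous on no `]0, γ]` -/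

/-- `log (g²)⁻¹ = −2 log g` (Mathlib's `Real.log` conventions make this an identity on all of `ℝ`). [folklore] -/
theorem log_sq_inv_eq (g : ℝ) : Real.log (g ^ 2)⁻¹ = -(2 * Real.log g) := by
  rw [Real.log_inv, Real.log_pow]
  push_cast
  ring

/-- `log (g²)⁻¹ → +∞` as `g → 0⁺`. [folklore] -/
theorem tendsto_log_sq_inv_nhdsGT_zero : Tendsto (fun g : ℝ => Real.log (g ^ 2)⁻¹) (𝓝[>] 0) atTop := by
  have h : Tendsto (fun g : ℝ => -(2 * Real.log g)) (𝓝[>] 0) atTop :=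
    tendsto_neg_atBot_atTop.comp (Real.tendsto_log_nhdsGT_zero.const_mul_atBot two_pos)
  refine h.congr fun g => ?_
  simp only [log_sq_inv_eq]

/-- (2.5): `(log g⁻²)^r ≤ R_k(g)` for the `R_k` of record (`Node00.isRj_RkOfRecord`), `L ≥ 2`. [cite: Balaban1988Convergent, (2.5) p.255] -/
theorem log_pow_le_RkOfRecord {L : ℕ} (hL : 2 ≤ L) (r : ℕ) (g : ℝ) :
    (Real.log (g ^ 2)⁻¹) ^ r ≤ (RkOfRecord L r g : ℝ) := by
  obtain ⟨s, -, h, -⟩ := isRj_RkOfRecord hL r g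
  exact h

/-- **`R_k` of record is unbounded as the coupling tends to `0⁺`** (`r ≥ 1`, `L ≥ 2`): `R_k(g) → ∞` along `𝓝[>] 0`.
[cite: Balaban1988Convergent, (2.5) p.255 (bookkeeping consequence)] -/
theorem tendsto_RkOfRecord_nhdsGT_zero {L : ℕ} (hL : 2 ≤ L) {r : ℕ} (hr : r ≠ 0) :
    Tendsto (fun g : ℝ => (RkOfRecord L r g : ℝ)) (𝓝[>] 0) atTop :=
  tendsto_atTop_mono (fun g => log_pow_le_RkOfRecord hL r g) ((tendsto_pow_atTop hr).comp tendsto_log_sq_inv_nhdsGT_zero)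

/-- In every box `]0, γ]` (`γ > 0`) the `R_k` of record takes a value different from its value at `γ` — the thresholds of the step
function (2.5) accumulate at `0⁺`. [cite: Balaban1988Convergent, (2.5) p.255 (bookkeeping consequence)] -/
theorem exists_RkOfRecord_ne_of_pos {L : ℕ} (hL : 2 ≤ L) {r : ℕ} (hr : r ≠ 0) {γ : ℝ} (hγ : 0 < γ) :
    ∃ g ∈ Set.Ioc 0 γ, RkOfRecord L r g ≠ RkOfRecord L r γ := by
  have hev : ∀ᶠ g : ℝ in 𝓝[>] 0, ((RkOfRecord L r γ : ℝ) + 1 ≤ (RkOfRecord L r g : ℝ)) ∧ g ∈ Set.Ioc 0 γ :=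
    ((tendsto_RkOfRecord_nhdsGT_zero hL hr).eventually_ge_atTop _).and (Ioc_mem_nhdsGT hγ)
  obtain ⟨g, hge, hg⟩ := hev.exists
  refine ⟨g, hg, fun heq => ?_⟩
  rw [heq] at hge
  linarith

/-- **`R_k` of record is continuous on NO box `]0, γ]`** (as an ℕ-valued map: a continuous map from a preconnected set to a discrete space is
constant, `IsPreconnected.constant`; but `R_k` is not constant on `]0, γ]`). [cite: Balaban1988Convergent, (2.5) p.255 (bookkeeping consequence)] -/
theorem not_continuousOn_RkOfRecord {L : ℕ} (hL : 2 ≤ L) {r : ℕ} (hr : r ≠ 0) {γ : ℝ} (hγ : 0 < γ) :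
    ¬ ContinuousOn (fun g : ℝ => RkOfRecord L r g) (Set.Ioc 0 γ) := by
  intro h
  obtain ⟨g, hg, hne⟩ := exists_RkOfRecord_ne_of_pos hL hr hγ
  exact hne (isPreconnected_Ioc.constant h hg ⟨hγ, le_rfl⟩)

/-- The same for the real-valued reading `g ↦ (R_k(g) : ℝ)` (the cast `ℕ → ℝ` is a closed embedding). [cite: Balaban1988Convergent, (2.5) p.255 (bookkeeping consequence)] -/
theorem not_continuousOn_RkOfRecord_real {L : ℕ} (hL : 2 ≤ L) {r : ℕ} (hr : r ≠ 0) {γ : ℝ} (hγ : 0 < γ) :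
    ¬ ContinuousOn (fun g : ℝ => (RkOfRecord L r g : ℝ)) (Set.Ioc 0 γ) := fun h =>
  not_continuousOn_RkOfRecord hL hr hγ (Nat.isClosedEmbedding_coe_real.isInducing.continuousOn_iff.mpr h)

/-- Hence every box `]0, γ]` contains a coupling at which `R_k` of record is DISCONTINUOUS (within the box).
[cite: Balaban1988Convergent, (2.5) p.255 (bookkeeping consequence)] -/
theorem exists_not_continuousWithinAt_RkOfRecord {L : ℕ} (hL : 2 ≤ L) {r : ℕ} (hr : r ≠ 0) {γ : ℝ} (hγ : 0 < γ) :
    ∃ g ∈ Set.Ioc 0 γ, ¬ ContinuousWithinAt (fun g : ℝ => (RkOfRecord L r g : ℝ)) (Set.Ioc 0 γ) g := by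
  by_contra h
  push Not at h
  exact not_continuousOn_RkOfRecord_real hL hr hγ h

/-! ## §2 The χ of record ([III] (2.17)) reads the coupling sequence at index `k` only, through the two channels `(R_k(g_k), ε_k(g))` -/

section Chi

variable (F : T4Family) (N : ℕ) [NeZero N]

/-- `χ_k` of record depends on the coupling sequence only through `g_k`. [cite: Balaban1988Convergent, (2.17) p.257 (bookkeeping)] -/
theorem chiOfRecord_congr (ν : Stage7Numerics) {g g' : ℕ → ℝ} (K k : ℕ) (h : g k = g' k) :
    chiOfRecord F N ν g K k = chiOfRecord F N ν g' K k := by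
  unfold chiOfRecord epsOfRecord
  rw [h]

/-- Stage 8's `χ` slot inherits it: `chi7 θ K g k` depends on `g` only through `g k`. [cite: Balaban1988Convergent, (2.17) p.257 (bookkeeping)] -/
theorem chi7_congr (θ : Stage8Params F N) {g g' : ℕ → ℝ} (K k : ℕ) (h : g k = g' k) :
    chi7 F N θ K g k = chi7 F N θ K g' k := by
  unfold chi7
  exact chiOfRecord_congr F N θ.ν K k h

/-- **The two channels**: `χ_k` of record depends on `g_k` only through the cube size `R_k(g_k)` of (2.5) (an ℕ-valued step function, §1) and the
small-field threshold `ε_k` of (2.4) (continuous, `continuousOn_epsChannel`). [cite: Balaban1988Convergent, (2.4)-(2.5) p.255 and (2.17) p.257 (bookkeeping)] -/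
theorem chiOfRecord_eq_of_channels_eq (ν : Stage7Numerics) {g g' : ℕ → ℝ} (K k : ℕ)
    (hR : RkOfRecord (F.P K).L ν.r (g k) = RkOfRecord (F.P K).L ν.r (g' k)) (hε : epsOfRecord ν g k = epsOfRecord ν g' k) :
    chiOfRecord F N ν g K k = chiOfRecord F N ν g' K k := by
  rw [chiOfRecord_eq_chi217, chiOfRecord_eq_chi217, hR, hε]

/-- The threshold channel `g ↦ g · A₀ (log g⁻²)^{p₀}` (= `epsOfRecord ν g k` at `g = g_k`, by `rfl`) is continuous on `]0, ∞[`.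
[cite: Balaban1988Convergent, (2.4) p.255 (bookkeeping)] -/
theorem continuousOn_epsChannel (A₀ : ℝ) (p₀ : ℕ) : ContinuousOn (fun x : ℝ => x * p0Profile A₀ p₀ x) (Set.Ioi 0) := by
  intro x hx
  have hx0 : x ≠ 0 := ne_of_gt hx
  have h1 : ContinuousAt (fun y : ℝ => (y ^ 2)⁻¹) x := (continuousAt_id.pow 2).inv₀ (pow_ne_zero 2 hx0)
  have h2 : ContinuousAt (fun y : ℝ => Real.log (y ^ 2)⁻¹) x := h1.log (inv_ne_zero (pow_ne_zero 2 hx0))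
  unfold p0Profile
  exact (continuousAt_id.mul (continuousAt_const.mul (h2.pow p₀))).continuousWithinAt

/-- `epsOfRecord ν g k` IS the threshold channel at `g_k` (`rfl`). [cite: Balaban1988Convergent, (2.4) p.255 (bookkeeping)] -/
theorem epsOfRecord_eq_channel (ν : Stage7Numerics) (g : ℕ → ℝ) (k : ℕ) :
    epsOfRecord ν g k = (fun x : ℝ => x * p0Profile ν.A₀ ν.p₀ x) (g k) := rfl

end Chi

/-! ## §3 Where this sits in the β-layer: the merged term family, unfolded one step -/

/-- The clamped extension of a history reads its LAST entry at index `k`: `extd (g_0,…,g_k) k = g_k`. [folklore] -/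
theorem extd_apply_last {k : ℕ} (v : Fin (k + 1) → ℝ) : extd v k = v (Fin.last k) := by
  simpa using T4FlagMemory.extd_coe v (Fin.last k)

section Merged

variable (F : T4Family) (N : ℕ) [NeZero N]

/-- **The β-layer's merged term family, unfolded ONE step** ([I] (1.6) with (0.19) WITH BODY): at history `hist = (g_0, …, g_k)` and matrix field `W`,
`𝓝_{k+1}(hist; W) = A_{k+1}(U) − A_k(Ū^k(U_k(U)))`, `U :=` the `SU(N)`-reading of `W`, where
`A_{k+1}(U) = log 𝐍_k⁻¹ · (TrhoOfRecord F N K k (χ_k · e^{−GF_k∕g_k² + A_k}))(U)` — the TRANSPORT OF RECORD (`Node00.TrhoOfRecord` = the Radon–Nikodym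
transport `AveragingRT.rnTransport`) applied at the point `U`, with the χ OF RECORD `χ K (extd hist) k` read AT `g_k = hist (Fin.last k)`.  This is the
functional whose Hessian at `W = exp(ρB)`, `B = 0`, windowed and taken to `K → ∞`, defines the Stage-8 β of record (`Node00.betaMerged`,
`Node00.Record8.betaOfRecord₈`). [cite: Balaban1987RG1, (0.19) p.255 and (1.6) p.261 and (1.20)-(1.22) p.264 (bookkeeping)] -/
theorem mergedTermFamilyMat_eq_nextAction_sub (χ : (K : ℕ) → (ℕ → ℝ) → (k : ℕ) → Density (F.P K) k (SU N)) (ε : ℝ)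
    (k : ℕ) (hist : Fin (k + 1) → ℝ) (K : ℕ) (W : Fin (F.P K).d → Site (F.P K) (k + 1) → Matrix (Fin N) (Fin N) ℂ) :
    mergedTermFamilyMat F N χ ε k hist K W =
      nextAction (TrhoOfRecord F N K k) (χ K (extd hist) k) (gfOfRecord F N K k) (hist (Fin.last k))
          (effActionH F N χ K (extd hist) k) (readField F N (suOfMat N) W) -
        effActionH F N χ K (extd hist) k
          (Averaging.iter (avOfRecord F N K) k (Uk F N K (k + 1) ε (readField F N (suOfMat N) W))) := by
  rw [mergedTermFamilyMat, mergedTermFamily_apply, mergedTerm, effActionH_succ, extd_apply_last]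

/-- In particular at NODE 00's Stage-8 parameters: the merged family OF RECORD `mergedTermFamilyMat F N (chi7 F N θ) θ.εbg` reads `chi7 F N θ K (extd hist) k`,
i.e. (`chi7_congr`, `extd_apply_last`) the χ of record AT THE LAST COUPLING `hist (Fin.last k)` — through `R_k` (§1: a step function with thresholds in
every box) and `ε_k` (§2: continuous). [cite: Balaban1987RG1, (1.6) p.261; Balaban1988Convergent, (2.17) p.257 (bookkeeping)] -/
theorem chi7_extd_eq_of_last_eq (θ : Stage8Params F N) {k : ℕ} {hist hist' : Fin (k + 1) → ℝ} (K : ℕ)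
    (h : hist (Fin.last k) = hist' (Fin.last k)) : chi7 F N θ K (extd hist) k = chi7 F N θ K (extd hist') k :=
  chi7_congr F N θ K k (by rw [extd_apply_last, extd_apply_last, h])

end Merged

end Summit.QuantumFields.YangMills.Theorems.BalabanUVNodesN26ChiStep

end
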